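import Mathlib
import Summits.Ventures.PercRepro2.HCov
import Summits.Ventures.PercRepro2.HCovCubic
import Summits.Ventures.PercRepro2.TriDisagreement
import Summits.Ventures.PercRepro2.TriDisagreementPinned
import Summits.Ventures.PercRepro2.TypedSplit
import Summits.Ventures.PercRepro2.OneTypedEdge
import Summits.Ventures.PercRepro2.StarPattern
import Summits.Ventures.PercRepro2.StarIdentities
import Summits.Ventures.PercRepro2.StarDebt
import Summits.Ventures.PercRepro2.ChainCoeff
import Summits.Ventures.PercRepro2.StarChain
import Summits.Ventures.PercRepro2.StarPayment
import Summits.Ventures.PercRepro2.StarDictionary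

/-!
# SENIOR-TWO — the senior-rooted two-piece form of the `(2,2,2)` hard step (blind cell
PercRepro2, p1 g13; ASSIGNMENTS v12.39 / v12.44 «SeniorTwoAt», HANDOFF «B-FORMS, THE SENIOR-TWO
PROP SHAPE», CONJECTURES row 45 sub-row SENIOR-TWO)

In the dictionary of `StarDictionary.lean` (`A = Λ(01;02;12)` the antichain leaf, `E_p = E(T;p)` the
chain leaf of the pair `p`, `B(T₁ + p₁) = B(T₁) + E_p`, `B(△₁) = B(T₁) + A + Σ_p E_p`) the lead's
SENIOR-ROOTED reading of the step picks ONE pair `p*` of the star — the pair AVOIDING the senior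
end — and asks that the antichain leaf be paid by `E_{p*}` together with the LARGER of the two
leaves of the pairs THROUGH the senior end:

`SENIOR-TWO(p*)  :  0 ≤ A + E_{p*} + max (E_q, E_r)`   (`{q, r}` the two pairs `≠ p*`),

equivalently (**`seniorTwoAt_iff_leaves`**) `min (B(T₁ + q₁), B(T₁ + r₁)) ≤ B(△₁)` — the B-form in
which it is DEFINED here (**`SeniorTwoAt i`**, `i` the index of `p*` in `pairPat`; the two pairs
through the senior end are `pairPat (i + 1)` and `pairPat (i + 2)`). It sits strictly between the
two-largest rule and TvT:

* `SeniorTwoAt i ⟹ TwoLargest` (**`seniorTwoAt_imp_twoLargest`**: the minimum over two pairs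
  dominates the minimum over all three), and `TwoLargest ⟺ ∃ i, SeniorTwoAt i`
  (**`twoLargest_iff_exists_seniorTwoAt`**);
* `TvT ⟺ 0 ≤ SENIOR-TWO(p*) + min (E_q, E_r)` (**`tvT_iff_seniorTwoAt_add_min`**: the lead's
  «TvT = SENIOR-TWO + min(E_s1, E_s2)»), so under chain positivity
  `SeniorTwoAt i ∧ TriCH ⟹ TvT ⟹ 0 ≤ N_(2,2,2)` (**`tvT_of_seniorTwoAt_of_triCH`**,
  **`typedCount_222_nonneg_of_seniorTwoAt_of_triCH`**).

The INSTANTIATION OF RECORD fixes `p*` from the marks: the SENIOR END of the star is the end of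
smallest role index in the order `o < a₁ < a₂ < a₃ < b` (unmarked ends are junior; ties broken by
the end index) — `roleIndex`, `seniorEnd` (certified by **`roleIndex_seniorEnd_le`**), the avoiding
pair `avoidingPair` (end `u₁ ↦ 12`, `u₂ ↦ 02`, `u₃ ↦ 01`) — and **`SeniorTwo u₁ u₂ u₃ :=
SeniorTwoAt (avoidingPair (seniorEnd …))`**, with the same implications
(**`seniorTwo_imp_twoLargest`**, **`tvT_of_seniorTwo_of_triCH`**,
**`typedCount_222_nonneg_of_seniorTwo_of_triCH`**).

Definitions and kernel implications only: NO positivity claim is proved. STATUS of the statement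
(lead g22, 2026-08-24 18:23Z–19:09Z; CONJECTURES row 45 sub-row): SENIOR-TWO is a CANDIDATE
strengthening of TvT — not of record — two codes and 0 failures on every class either seat ran
(lead: the `≤ 3` unions, the 99,386-orbit union with 33 tight vectors, the random fully-reduced
census j225464, mode k ≤ 2 = kit j226183: 6,026,400 instances, 13,348 leaf vectors, 245 with
`Λ < 0`, SENIOR-TWO 0 failures; engine: the (n) census j226132, 42.5 M `(2,2,2)` instances with
U = 1, 2 unmarked ends, mode c ≤ 4 50.1 M, D207 addendum 6 — the Prop gate «mode k ≤ 2 clean»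
opened 2026-08-24T19:55Z);
its relabellings (any other choice of `i`) fail, as does every single-pair form (witness
`A + E₀ + E₂ = −2`). SCOPE (NEG-108): the one-rung-down objects of GRAPHS with ONE star at `y`,
ends arbitrary, and the five-mark base — never typed hypergraphs with unmarked vertices.
-/

namespace Summit.Ventures.PercRepro2

open CovForm CovForm.OneTyped CovForm.TypedRed

namespace StarPattern

/-! ## The senior-rooted two-piece rule at a named pair -/

section SeniorDefs

variable {V : Type*} {E : Type*} [Fintype E] [DecidableEq E] {R : Type*} [Field R] [LinearOrder R]

/-- **The pair of the star avoiding an end**: `avoidingPair 0 = 2` (the pair `12 = s₂s₃` avoids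
`u₁`), `avoidingPair 1 = 1` (`02` avoids `u₂`), `avoidingPair 2 = 0` (`01` avoids `u₃`); the two
pairs THROUGH the end `e` are `avoidingPair e + 1` and `avoidingPair e + 2`. -/
def avoidingPair : Fin 3 → Fin 3 := ![2, 1, 0]

/-- The pair avoiding the end `u₁` is `12` (`pairPat 2`). -/
@[simp] lemma avoidingPair_zero : avoidingPair 0 = 2 := rfl

/-- The pair avoiding the end `u₂` is `02` (`pairPat 1`). -/
@[simp] lemma avoidingPair_one : avoidingPair 1 = 1 := rfl

/-- The pair avoiding the end `u₃` is `01` (`pairPat 0`). -/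
@[simp] lemma avoidingPair_two : avoidingPair 2 = 0 := rfl

/-- `avoidingPair` is the involution `e ↦ 2 − e` of `Fin 3`. -/
lemma avoidingPair_avoidingPair (e : Fin 3) : avoidingPair (avoidingPair e) = e := by
  fin_cases e <;> rfl

variable (ends : E → Sym2 V) (o a₁ a₂ a₃ b : V) (s₁ s₂ s₃ : E) (F₀ : Finset E) (z₀ : Config E)
  (τ : E → ℕ)

/-- **SENIOR-TWO at the pair `i`** (the lead's senior-rooted two-piece form, B-form): the triangle
base dominates the smaller of the two one-pair bases of the pairs `≠ i`,
`min (B(T₁ + q₁), B(T₁ + r₁)) ≤ B(△₁)` for `{q, r} = {i + 1, i + 2}` — equivalently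
`0 ≤ Λ(01;02;12) + E(T; i) + max (E(T; q), E(T; r))` (`seniorTwoAt_iff_leaves`). A definition only.
The instantiation of record takes `i = avoidingPair (seniorEnd …)`, the pair AVOIDING the senior
end (`SeniorTwo`); the other two instantiations are its relabellings, which FAIL on the census.
SCOPE (NEG-108): a CANDIDATE (two codes, 0 failures on every class run, not of record) for the
one-rung-down objects of GRAPHS with ONE star at `y`, ends arbitrary, and the five-mark base; never
typed hypergraphs with unmarked vertices. -/
def SeniorTwoAt (i : Fin 3) : Prop :=
  min (Btwo (R := R) ends o a₁ a₂ a₃ b s₁ s₂ s₃ F₀ z₀ τ (pairPat (i + 1)) (true, true, true))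
      (Btwo ends o a₁ a₂ a₃ b s₁ s₂ s₃ F₀ z₀ τ (pairPat (i + 2)) (true, true, true)) ≤
    Btriangle ends o a₁ a₂ a₃ b s₁ s₂ s₃ F₀ z₀ τ

/-- `SeniorTwoAt i` as a disjunction: one of the two pairs through the senior end has
`B(T₁ + p₁) ≤ B(△₁)`. -/
theorem seniorTwoAt_iff_or (i : Fin 3) :
    SeniorTwoAt (R := R) ends o a₁ a₂ a₃ b s₁ s₂ s₃ F₀ z₀ τ i ↔
      Btwo (R := R) ends o a₁ a₂ a₃ b s₁ s₂ s₃ F₀ z₀ τ (pairPat (i + 1)) (true, true, true) ≤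
          Btriangle ends o a₁ a₂ a₃ b s₁ s₂ s₃ F₀ z₀ τ ∨
        Btwo (R := R) ends o a₁ a₂ a₃ b s₁ s₂ s₃ F₀ z₀ τ (pairPat (i + 2)) (true, true, true) ≤
          Btriangle ends o a₁ a₂ a₃ b s₁ s₂ s₃ F₀ z₀ τ := by
  unfold SeniorTwoAt
  exact min_le_iff

/-- A pair `j ≠ i` with `B(T₁ + j₁) ≤ B(△₁)` gives `SeniorTwoAt i`. -/
theorem seniorTwoAt_of_le (i j : Fin 3) (hij : j ≠ i)
    (h : Btwo (R := R) ends o a₁ a₂ a₃ b s₁ s₂ s₃ F₀ z₀ τ (pairPat j) (true, true, true) ≤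
      Btriangle ends o a₁ a₂ a₃ b s₁ s₂ s₃ F₀ z₀ τ) :
    SeniorTwoAt (R := R) ends o a₁ a₂ a₃ b s₁ s₂ s₃ F₀ z₀ τ i := by
  rw [seniorTwoAt_iff_or]
  fin_cases i <;> fin_cases j <;> simp_all

end SeniorDefs

/-! ## The leaf form, the `TvT = SENIOR-TWO + min` reading and the chain to the hard step -/

section SeniorLeaves

variable {V : Type*} {E : Type*} [Fintype E] [DecidableEq E] {R : Type*} [Field R] [LinearOrder R]
  [IsStrictOrderedRing R]

/-- `0 ≤ c + max x y` iff one of the two summands pays. -/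
private lemma nonneg_add_max_iff {c x y : R} : 0 ≤ c + max x y ↔ 0 ≤ c + x ∨ 0 ≤ c + y := by
  rcases le_total x y with h | h
  · rw [max_eq_right h]
    constructor
    · intro h'; exact Or.inr h'
    · rintro (h' | h') <;> linarith
  · rw [max_eq_left h]
    constructor
    · intro h'; exact Or.inl h'
    · rintro (h' | h') <;> linarith

/-- `max + min = sum`, in the form used for the `TvT = SENIOR-TWO + min` reading. -/
private lemma nonneg_add_max_add_min_iff {c x y : R} :
    0 ≤ c + max x y + min x y ↔ 0 ≤ c + x + y := by
  rcases le_total x y with h | h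
  · rw [max_eq_right h, min_eq_left h]
    constructor <;> intro h' <;> linarith
  · rw [max_eq_left h, min_eq_right h]

variable (ends : E → Sym2 V) (o a₁ a₂ a₃ b : V) (s₁ s₂ s₃ : E) (F₀ : Finset E) (z₀ : Config E)
  (τ : E → ℕ)

/-- **`SeniorTwoAt i ⟹ TwoLargest`**: the minimum over the two pairs through the senior end
dominates the minimum over all three pairs. -/
theorem seniorTwoAt_imp_twoLargest (i : Fin 3)
    (h : SeniorTwoAt (R := R) ends o a₁ a₂ a₃ b s₁ s₂ s₃ F₀ z₀ τ i) :
    TwoLargest (R := R) ends o a₁ a₂ a₃ b s₁ s₂ s₃ F₀ z₀ τ := by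
  rw [twoLargest_iff_min, min_le_iff, min_le_iff]
  rw [seniorTwoAt_iff_or] at h
  fin_cases i <;>
    simp only [Fin.zero_eta, Fin.mk_one, Fin.reduceFinMk, Fin.isValue, Fin.reduceAdd] at h
  · exact Or.inr h
  · rcases h with h | h
    · exact Or.inr (Or.inr h)
    · exact Or.inl h
  · rcases h with h | h
    · exact Or.inl h
    · exact Or.inr (Or.inl h)

/-- **`TwoLargest ⟺ ∃ i, SeniorTwoAt i`**: the two-largest rule is SENIOR-TWO at SOME pair. -/
theorem twoLargest_iff_exists_seniorTwoAt :
    TwoLargest (R := R) ends o a₁ a₂ a₃ b s₁ s₂ s₃ F₀ z₀ τ ↔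
      ∃ i : Fin 3, SeniorTwoAt (R := R) ends o a₁ a₂ a₃ b s₁ s₂ s₃ F₀ z₀ τ i := by
  constructor
  · intro h
    rw [twoLargest_iff_min, min_le_iff, min_le_iff] at h
    rcases h with h | h | h
    · exact ⟨2, seniorTwoAt_of_le ends o a₁ a₂ a₃ b s₁ s₂ s₃ F₀ z₀ τ 2 0 (by decide) h⟩
    · exact ⟨0, seniorTwoAt_of_le ends o a₁ a₂ a₃ b s₁ s₂ s₃ F₀ z₀ τ 0 1 (by decide) h⟩
    · exact ⟨0, seniorTwoAt_of_le ends o a₁ a₂ a₃ b s₁ s₂ s₃ F₀ z₀ τ 0 2 (by decide) h⟩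
  · rintro ⟨i, h⟩
    exact seniorTwoAt_imp_twoLargest ends o a₁ a₂ a₃ b s₁ s₂ s₃ F₀ z₀ τ i h

/-- **SENIOR-TWO in leaves**: `SeniorTwoAt i ⟺ 0 ≤ Λ(01;02;12) + E(T; i) + max (E(T; i+1), E(T; i+2))`
— the antichain leaf is paid by the leaf of the avoiding pair `p*` plus the larger leaf of the two
pairs through the senior end. -/
theorem seniorTwoAt_iff_leaves (i : Fin 3) :
    SeniorTwoAt (R := R) ends o a₁ a₂ a₃ b s₁ s₂ s₃ F₀ z₀ τ i ↔
      0 ≤ antiCoeff (R := R) ends o a₁ a₂ a₃ b s₁ s₂ s₃ F₀ z₀ τ +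
        nestLeaf ends o a₁ a₂ a₃ b s₁ s₂ s₃ F₀ z₀ τ (pairPat i) +
        max (nestLeaf ends o a₁ a₂ a₃ b s₁ s₂ s₃ F₀ z₀ τ (pairPat (i + 1)))
          (nestLeaf ends o a₁ a₂ a₃ b s₁ s₂ s₃ F₀ z₀ τ (pairPat (i + 2))) := by
  rw [seniorTwoAt_iff_or, Btwo_eq_Bone_add_nestLeaf, Btwo_eq_Bone_add_nestLeaf, Btriangle_eq,
    nonneg_add_max_iff]
  fin_cases i <;>
    simp only [Fin.zero_eta, Fin.mk_one, Fin.reduceFinMk, Fin.isValue, Fin.reduceAdd, pairPat,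
      Matrix.cons_val_zero, Matrix.cons_val_one, Matrix.head_cons, Matrix.cons_val_two,
      Matrix.tail_cons] <;>
    constructor <;> rintro (h | h) <;> first | (left; linarith) | (right; linarith)

/-- **The lead's reading `TvT = SENIOR-TWO + min(E_s1, E_s2)`**: `B(T₁) ≤ B(△₁)` iff the SENIOR-TWO
expression at `i` plus the SMALLER leaf of the two pairs through the senior end is nonnegative. -/
theorem tvT_iff_seniorTwoAt_add_min (i : Fin 3) :
    TvT (R := R) ends o a₁ a₂ a₃ b s₁ s₂ s₃ F₀ z₀ τ ↔
      0 ≤ (antiCoeff (R := R) ends o a₁ a₂ a₃ b s₁ s₂ s₃ F₀ z₀ τ +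
          nestLeaf ends o a₁ a₂ a₃ b s₁ s₂ s₃ F₀ z₀ τ (pairPat i) +
          max (nestLeaf ends o a₁ a₂ a₃ b s₁ s₂ s₃ F₀ z₀ τ (pairPat (i + 1)))
            (nestLeaf ends o a₁ a₂ a₃ b s₁ s₂ s₃ F₀ z₀ τ (pairPat (i + 2)))) +
        min (nestLeaf ends o a₁ a₂ a₃ b s₁ s₂ s₃ F₀ z₀ τ (pairPat (i + 1)))
          (nestLeaf ends o a₁ a₂ a₃ b s₁ s₂ s₃ F₀ z₀ τ (pairPat (i + 2))) := by
  rw [tvT_iff, nonneg_add_max_add_min_iff]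
  fin_cases i <;>
    simp only [Fin.zero_eta, Fin.mk_one, Fin.reduceFinMk, Fin.isValue, Fin.reduceAdd, pairPat,
      Matrix.cons_val_zero, Matrix.cons_val_one, Matrix.head_cons, Matrix.cons_val_two,
      Matrix.tail_cons] <;>
    constructor <;> intro h <;> linarith

/-- **Under chain positivity SENIOR-TWO gives TvT**: `SeniorTwoAt i ∧ TriCH ⟹ TvT` (the remaining
chain leaf `min (E_q, E_r)` is `≥ 0`). -/
theorem tvT_of_seniorTwoAt_of_triCH (i : Fin 3)
    (hS : SeniorTwoAt (R := R) ends o a₁ a₂ a₃ b s₁ s₂ s₃ F₀ z₀ τ i)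
    (hCH : TriCH (R := R) ends o a₁ a₂ a₃ b s₁ s₂ s₃ F₀ z₀ τ) :
    TvT (R := R) ends o a₁ a₂ a₃ b s₁ s₂ s₃ F₀ z₀ τ :=
  tvT_of_twoLargest_of_triCH ends o a₁ a₂ a₃ b s₁ s₂ s₃ F₀ z₀ τ
    (seniorTwoAt_imp_twoLargest ends o a₁ a₂ a₃ b s₁ s₂ s₃ F₀ z₀ τ i hS) hCH

variable {ends} {o a₁ a₂ a₃ b} {s₁ s₂ s₃} {F₀} {z₀} {τ} {y u₁ u₂ u₃ : V}

/-- **The chain of record from SENIOR-TWO**: `SeniorTwoAt i ∧ TriCH` (one rung down) `⟹ 0 ≤ N_(2,2,2)`. -/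
theorem typedCount_222_nonneg_of_seniorTwoAt_of_triCH (F : Finset E) (z : Config E) (τ : E → ℕ)
    (D : StarData ends o a₁ a₂ a₃ b s₁ s₂ s₃ y u₁ u₂ u₃ (((F.erase s₁).erase s₂).erase s₃)
      (Function.update (Function.update (Function.update z s₁ false) s₂ false) s₃ false))
    (hs₁ : s₁ ∈ F) (hs₂ : s₂ ∈ F) (hs₃ : s₃ ∈ F) (hτ₁ : τ s₁ = 2) (hτ₂ : τ s₂ = 2)
    (hτ₃ : τ s₃ = 2) (i : Fin 3)
    (hS : SeniorTwoAt (R := R) ends o a₁ a₂ a₃ b s₁ s₂ s₃ (((F.erase s₁).erase s₂).erase s₃)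
      (Function.update (Function.update (Function.update z s₁ false) s₂ false) s₃ false) τ i)
    (hCH : TriCH (R := R) ends o a₁ a₂ a₃ b s₁ s₂ s₃ (((F.erase s₁).erase s₂).erase s₃)
      (Function.update (Function.update (Function.update z s₁ false) s₂ false) s₃ false) τ) :
    0 ≤ typedCount F z τ (K3 ends o a₁ a₂ a₃ b : Config E → Config E → Config E → R) :=
  typedCount_222_nonneg_of_tvT_of_triCH F z τ D hs₁ hs₂ hs₃ hτ₁ hτ₂ hτ₃
    (tvT_of_seniorTwoAt_of_triCH ends o a₁ a₂ a₃ b s₁ s₂ s₃ _ _ τ i hS hCH) hCH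

end SeniorLeaves

/-! ## The instantiation of record: the senior end from the marks -/

section SeniorEnd

variable {V : Type*} [DecidableEq V]

/-- **The role index** of a vertex in the order `o < a₁ < a₂ < a₃ < b`: `0` for `o`, `1` for `a₁`,
`2` for `a₂`, `3` for `a₃`, `4` for `b`, `5` for an unmarked vertex (the first match wins). -/
def roleIndex (o a₁ a₂ a₃ b v : V) : ℕ :=
  if v = o then 0 else if v = a₁ then 1 else if v = a₂ then 2 else if v = a₃ then 3
    else if v = b then 4 else 5

/-- The origin `o` has role index `0`. -/
@[simp] lemma roleIndex_o (o a₁ a₂ a₃ b : V) : roleIndex o a₁ a₂ a₃ b o = 0 := by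
  simp [roleIndex]

/-- Every role index is at most `5`. -/
lemma roleIndex_le_five (o a₁ a₂ a₃ b v : V) : roleIndex o a₁ a₂ a₃ b v ≤ 5 := by
  unfold roleIndex
  split_ifs <;> omega

/-- An unmarked vertex has role index `5` (it is junior to every mark). -/
lemma roleIndex_of_unmarked {o a₁ a₂ a₃ b v : V} (ho : v ≠ o) (h1 : v ≠ a₁) (h2 : v ≠ a₂)
    (h3 : v ≠ a₃) (hb : v ≠ b) : roleIndex o a₁ a₂ a₃ b v = 5 := by
  simp [roleIndex, ho, h1, h2, h3, hb]

/-- **The senior end** of the star with ends `u₁, u₂, u₃`: the index of the end of smallest role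
index (the mark end nearest `o`; unmarked ends are junior), ties broken by the smaller end index. -/
def seniorEnd (o a₁ a₂ a₃ b u₁ u₂ u₃ : V) : Fin 3 :=
  if roleIndex o a₁ a₂ a₃ b u₂ < roleIndex o a₁ a₂ a₃ b u₁ then
    (if roleIndex o a₁ a₂ a₃ b u₃ < roleIndex o a₁ a₂ a₃ b u₂ then 2 else 1)
  else (if roleIndex o a₁ a₂ a₃ b u₃ < roleIndex o a₁ a₂ a₃ b u₁ then 2 else 0)

/-- **`seniorEnd` minimises the role index over the three ends.** -/
theorem roleIndex_seniorEnd_le (o a₁ a₂ a₃ b u₁ u₂ u₃ : V) (j : Fin 3) :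
    roleIndex o a₁ a₂ a₃ b (![u₁, u₂, u₃] (seniorEnd o a₁ a₂ a₃ b u₁ u₂ u₃)) ≤
      roleIndex o a₁ a₂ a₃ b (![u₁, u₂, u₃] j) := by
  unfold seniorEnd
  split_ifs with h₁ h₂ h₃ <;> fin_cases j <;>
    simp only [Fin.zero_eta, Fin.mk_one, Fin.reduceFinMk, Fin.isValue, Matrix.cons_val_zero,
      Matrix.cons_val_one, Matrix.head_cons, Matrix.cons_val_two, Matrix.tail_cons] <;> omega

/-- If `u₁` is the origin `o` it is the senior end. -/
lemma seniorEnd_eq_zero_of_left (o a₁ a₂ a₃ b u₂ u₃ : V) :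
    seniorEnd o a₁ a₂ a₃ b o u₂ u₃ = 0 := by
  simp [seniorEnd]

end SeniorEnd

section SeniorRecord

variable {V : Type*} {E : Type*} [DecidableEq V] [Fintype E] [DecidableEq E] {R : Type*} [Field R]
  [LinearOrder R]

variable (ends : E → Sym2 V) (o a₁ a₂ a₃ b : V) (s₁ s₂ s₃ : E) (F₀ : Finset E) (z₀ : Config E)
  (τ : E → ℕ)

/-- **SENIOR-TWO, the instantiation of record** at a star with ends `u₁, u₂, u₃` (`s_k = {y, u_k}`):
`SeniorTwoAt` at the pair AVOIDING the senior end, `min (B(T₁ + s₁₁), B(T₁ + s₂₁)) ≤ B(△₁)` over the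
two pairs `s₁, s₂` through the senior end. A definition only; STATUS and SCOPE as `SeniorTwoAt`. -/
def SeniorTwo (u₁ u₂ u₃ : V) : Prop :=
  SeniorTwoAt (R := R) ends o a₁ a₂ a₃ b s₁ s₂ s₃ F₀ z₀ τ
    (avoidingPair (seniorEnd o a₁ a₂ a₃ b u₁ u₂ u₃))

variable [IsStrictOrderedRing R]

/-- **`SeniorTwo ⟹ TwoLargest`.** -/
theorem seniorTwo_imp_twoLargest (u₁ u₂ u₃ : V)
    (h : SeniorTwo (R := R) ends o a₁ a₂ a₃ b s₁ s₂ s₃ F₀ z₀ τ u₁ u₂ u₃) :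
    TwoLargest (R := R) ends o a₁ a₂ a₃ b s₁ s₂ s₃ F₀ z₀ τ :=
  seniorTwoAt_imp_twoLargest ends o a₁ a₂ a₃ b s₁ s₂ s₃ F₀ z₀ τ _ h

/-- **`SeniorTwo ∧ TriCH ⟹ TvT`.** -/
theorem tvT_of_seniorTwo_of_triCH (u₁ u₂ u₃ : V)
    (hS : SeniorTwo (R := R) ends o a₁ a₂ a₃ b s₁ s₂ s₃ F₀ z₀ τ u₁ u₂ u₃)
    (hCH : TriCH (R := R) ends o a₁ a₂ a₃ b s₁ s₂ s₃ F₀ z₀ τ) :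
    TvT (R := R) ends o a₁ a₂ a₃ b s₁ s₂ s₃ F₀ z₀ τ :=
  tvT_of_seniorTwoAt_of_triCH ends o a₁ a₂ a₃ b s₁ s₂ s₃ F₀ z₀ τ _ hS hCH

variable {ends} {o a₁ a₂ a₃ b} {s₁ s₂ s₃} {F₀} {z₀} {τ} {y u₁ u₂ u₃ : V}

/-- **The chain of record from the instantiation of record**: `SeniorTwo u₁ u₂ u₃ ∧ TriCH` (one rung
down, at the star `y — u₁, u₂, u₃`) `⟹ 0 ≤ N_(2,2,2)`. -/
theorem typedCount_222_nonneg_of_seniorTwo_of_triCH (F : Finset E) (z : Config E) (τ : E → ℕ)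
    (D : StarData ends o a₁ a₂ a₃ b s₁ s₂ s₃ y u₁ u₂ u₃ (((F.erase s₁).erase s₂).erase s₃)
      (Function.update (Function.update (Function.update z s₁ false) s₂ false) s₃ false))
    (hs₁ : s₁ ∈ F) (hs₂ : s₂ ∈ F) (hs₃ : s₃ ∈ F) (hτ₁ : τ s₁ = 2) (hτ₂ : τ s₂ = 2)
    (hτ₃ : τ s₃ = 2)
    (hS : SeniorTwo (R := R) ends o a₁ a₂ a₃ b s₁ s₂ s₃ (((F.erase s₁).erase s₂).erase s₃)
      (Function.update (Function.update (Function.update z s₁ false) s₂ false) s₃ false) τ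
      u₁ u₂ u₃)
    (hCH : TriCH (R := R) ends o a₁ a₂ a₃ b s₁ s₂ s₃ (((F.erase s₁).erase s₂).erase s₃)
      (Function.update (Function.update (Function.update z s₁ false) s₂ false) s₃ false) τ) :
    0 ≤ typedCount F z τ (K3 ends o a₁ a₂ a₃ b : Config E → Config E → Config E → R) :=
  typedCount_222_nonneg_of_seniorTwoAt_of_triCH F z τ D hs₁ hs₂ hs₃ hτ₁ hτ₂ hτ₃ _ hS hCH

end SeniorRecord

end StarPattern

end Summit.Ventures.PercRepro2
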